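import Summits.HodgeConjecture.HodgeConjecture.Theorems.MilnorKExponentialSymbolLiftRMilnorTransgression
import Summits.HodgeConjecture.HodgeConjecture.Theorems.MilnorKExponentialSymbolLiftRTransgressionClass
import Literature.AlgebraicGeometry.HodgeTheory.SymbolClasses
import HarnessLib

/-!
# `HasSymbolCocycle` is "a Milnor cocycle whose transgressed class is `m • A^* c`": the zig-zag is not data

Theorems file of route `MilnorKExponential` of the Hodge summit, crux `SymbolLiftR`
(stmt-HodgeConjecture-18702), line `lefschetz-fold`, kernel `stub_primitiveLiftExists` (LIFT_p for
primitive rational `(p,p)` classes, `2 ≤ p ≤ n/2`).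

`HodgeModel.HasSymbolCocycle q c` quantifies existentially over a cover, a Milnor symbol cocycle
`σ`, a closed form `θ`, a zig-zag from the symbol forms of `σ` to `θ`, and an integer `m ≠ 0` with
`A.deRham [θ] = m • A^* c`. By the existence of zig-zags for every Milnor cocycle on the (σ-compact,
Hausdorff) carrier of a Hodge model (`exists_isTransgression_of_cover`, file `…MilnorTransgression`)
and the independence of the transgressed class from the zig-zag (`IsTransgression.mk_eq_mk_of_cover`,
file `…TransgressionClass`), the zig-zag and the form carry no information: `HasSymbolCocycle q c`
holds iff there is a Milnor cocycle `σ` and `m ≠ 0` such that EVERY transgression `θ` of the symbol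
forms of `σ` has `A.deRham [θ] = m • A^* c` (`hasSymbolCocycle_iff_forall_transgression`), iff
there are `σ`, `m ≠ 0` and SOME transgression with that class (the definition). So a proof of the
kernel for a class `c` consists of exactly two things: a cocycle, and one class computation — for
which any zig-zag may be used (`hasSymbolCocycle_of_cocycle_of_transgression`).

References: R. Bott, L. W. Tu, *Differential Forms in Algebraic Topology* (1982), Prop. 8.8;
H. Esnault, E. Viehweg, *Deligne–Beilinson cohomology* (1988), §7.
-/

noncomputable section

-- The mandated namespace repeats `HodgeConjecture` (single-conjunct summit).
set_option linter.dupNamespace false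

open scoped Manifold Topology ContDiff
open Set Function Filter

namespace Summit.HodgeConjecture.HodgeConjecture.Theorems.SymbolLiftR

open Literature.Geometry.Kaehler Literature.NumberTheory.Transcendental
open Literature.AlgebraicGeometry Literature.AlgebraicGeometry.HodgeTheory

variable {n : ℕ} {X : Motives.SchemeOver ℂ}

/-- **`HasSymbolCocycle` ⟺ a Milnor cocycle all of whose transgressions have class `m • A^* c`.**
For a Hodge model `A` (carrier σ-compact and Hausdorff): `A.HasSymbolCocycle q c` iff there are a
finite open cover, a Čech `(q+1)`-cocycle `σ` of Milnor symbols of weight `q + 1` modulo the naive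
relations, and an integer `m ≠ 0`, such that for EVERY closed smooth form `θ` reached from the
symbol forms of `σ` by a Čech–de Rham zig-zag, `A.deRham [θ] = m • A^* c`. (`→`: the witness `θ₀`
has this class and any other transgression is cohomologous to it, `IsTransgression.mk_eq_mk_of_cover`;
`←`: a transgression exists, `exists_isTransgression_of_cover`.) [cite: BottTu1982Forms, §8 Prop. 8.8] -/
theorem _root_.Literature.AlgebraicGeometry.HodgeTheory.HodgeModel.hasSymbolCocycle_iff_forall_transgression
    (A : HodgeModel n X) (q : ℕ) (c : complexBetti X (2 * (q + 1))) :
    A.HasSymbolCocycle q c ↔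
      ∃ (ι : Type) (_ : Fintype ι) (U : ι → Set A.carrier) (hU : ∀ i, IsOpen (U i))
        (_ : ∀ x, ∃ i, x ∈ U i) (σ : (Fin (q + 2) → ι) → ((Fin (q + 1) → (A.carrier → ℂ)) →₀ ℤ))
        (_ : IsMilnorSymbolCocycle A.model U σ) (m : ℤ), m ≠ 0 ∧
        ∀ θ : cclosedSmoothForms A.model A.carrier (2 * q + 1 + 1),
          IsTransgression hU q (fun J ↦ symbolForm A.model (q + 1) (σ J)) θ →
            A.deRham A.carrier (2 * q + 1 + 1)
                (complexDeRhamCohomology.mk A.model A.carrier (2 * q + 1 + 1) θ) =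
              (m : ℂ) • A.pullback (2 * q + 1 + 1) c := by
  constructor
  · rintro ⟨ι, hι, U, hU, hcov, σ, hσ, θ₀, m, hm, hT₀, hdR⟩
    refine ⟨ι, hι, U, hU, hcov, σ, hσ, m, hm, fun θ hT ↦ ?_⟩
    rw [hT.mk_eq_mk_of_cover hcov hT₀]
    exact hdR
  · rintro ⟨ι, hι, U, hU, hcov, σ, hσ, m, hm, hall⟩
    obtain ⟨θ, hT⟩ := exists_isTransgression_of_cover hU hcov hσ
    exact ⟨ι, hι, U, hU, hcov, σ, hσ, θ, m, hm, hT, hall θ hT⟩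

/-- **The working criterion.** To prove `A.HasSymbolCocycle q c` it suffices to give a Milnor symbol
cocycle `σ` on a finite open cover of `A.carrier`, an integer `m ≠ 0`, and ONE transgression `θ₁` of
the symbol forms of `σ` — ANY one, e.g. an explicit staircase convenient for computation — with
`A.deRham [θ₁] = m • A^* c` (this is the definition; recorded next to the `iff` as the form in which
the kernel is attacked: cocycle + one class computation). [cite: BottTu1982Forms, §8 Prop. 8.8] -/
theorem _root_.Literature.AlgebraicGeometry.HodgeTheory.HodgeModel.hasSymbolCocycle_of_cocycle_of_transgression
    (A : HodgeModel n X) {q : ℕ} {c : complexBetti X (2 * (q + 1))}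
    {ι : Type} [Fintype ι] {U : ι → Set A.carrier} (hU : ∀ i, IsOpen (U i)) (hcov : ∀ x, ∃ i, x ∈ U i)
    {σ : (Fin (q + 2) → ι) → ((Fin (q + 1) → (A.carrier → ℂ)) →₀ ℤ)}
    (hσ : IsMilnorSymbolCocycle A.model U σ) {m : ℤ} (hm : m ≠ 0)
    (θ₁ : cclosedSmoothForms A.model A.carrier (2 * q + 1 + 1))
    (hT₁ : IsTransgression hU q (fun J ↦ symbolForm A.model (q + 1) (σ J)) θ₁)
    (hclass : A.deRham A.carrier (2 * q + 1 + 1)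
        (complexDeRhamCohomology.mk A.model A.carrier (2 * q + 1 + 1) θ₁) =
      (m : ℂ) • A.pullback (2 * q + 1 + 1) c) :
    A.HasSymbolCocycle q c :=
  ⟨ι, inferInstance, U, hU, hcov, σ, hσ, θ₁, m, hm, hT₁, hclass⟩

/-- **Any two transgressions of one Milnor cocycle on a Hodge model read the same class through
`A.deRham`** (so the integer `m` and the class `c` in `HasSymbolCocycle` are determined by `σ` up to
the common factor). [cite: BottTu1982Forms, §8 Prop. 8.8] -/
theorem _root_.Literature.AlgebraicGeometry.HodgeTheory.HodgeModel.deRham_mk_eq_of_isTransgression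
    (A : HodgeModel n X) {q : ℕ} {ι : Type} [Fintype ι] {U : ι → Set A.carrier}
    {hU : ∀ i, IsOpen (U i)} (hcov : ∀ x, ∃ i, x ∈ U i)
    {w : (Fin (q + 2) → ι) → MForm 𝓘(ℝ, A.model) A.carrier ℂ (q + 1)}
    {θ₁ θ₂ : cclosedSmoothForms A.model A.carrier (2 * q + 1 + 1)}
    (h₁ : IsTransgression hU q w θ₁) (h₂ : IsTransgression hU q w θ₂) :
    A.deRham A.carrier (2 * q + 1 + 1) (complexDeRhamCohomology.mk A.model A.carrier (2 * q + 1 + 1) θ₁) =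
      A.deRham A.carrier (2 * q + 1 + 1) (complexDeRhamCohomology.mk A.model A.carrier (2 * q + 1 + 1) θ₂) := by
  rw [h₁.mk_eq_mk_of_cover hcov h₂]

/-- STUB `stub_hasSymbolCocycle_iff_forall_transgression` (helper sub-goal registered on
stmt-HodgeConjecture-18702 for the kernel `stub_primitiveLiftExists`: in `HasSymbolCocycle` the
zig-zag and the form are not data — a cocycle and one class computation suffice):
`HodgeModel.hasSymbolCocycle_iff_forall_transgression`, stated closed. [cite: BottTu1982Forms, §8 Prop. 8.8] -/
theorem stub_hasSymbolCocycle_iff_forall_transgression : ∀ {n : ℕ} {X : Literature.AlgebraicGeometry.Motives.SchemeOver ℂ} (A : Literature.AlgebraicGeometry.HodgeTheory.HodgeModel n X) (q : ℕ) (c : Literature.AlgebraicGeometry.HodgeTheory.complexBetti X (2 * (q + 1))), A.HasSymbolCocycle q c ↔ ∃ (ι : Type) (_ : Fintype ι) (U : ι → Set A.carrier) (hU : ∀ i, IsOpen (U i)) (_ : ∀ x, ∃ i, x ∈ U i) (σ : (Fin (q + 2) → ι) → ((Fin (q + 1) → (A.carrier → ℂ)) →₀ ℤ)) (_ : IsMilnorSymbolCocycle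 A.model U σ) (m : ℤ), m ≠ 0 ∧ ∀ θ : cclosedSmoothForms A.model A.carrier (2 * q + 1 + 1), IsTransgression hU q (fun J ↦ symbolForm A.model (q + 1) (σ J)) θ → A.deRham A.carrier (2 * q + 1 + 1) (complexDeRhamCohomology.mk A.model A.carrier (2 * q + 1 + 1) θ) = (m : ℂ) • A.pullback (2 * q + 1 + 1) c :=
  fun A q c ↦ A.hasSymbolCocycle_iff_forall_transgression q c

end Summit.HodgeConjecture.HodgeConjecture.Theorems.SymbolLiftR

end
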